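import Summits.NavierStokesRegularity.FunctionalMining.TopEigHeatLine
import Mathlib.Analysis.Convex.SpecificFunctions.Basic
import HarnessLib

/-!
# FunctionalMining — ε-uniform form of the `T_LD` inequality for the regularised `λ₁`-moment

Search for candidate a priori estimates; no regularity claim. Cell `pub-nsfunc`, prove seat
(gen 17). Kernel support for Theorem G (ii) of SIEVELD §3.4 (`TopEigTLDOfCoercive`): the
differential inequality of `TopEigBalanceTLD` for the mollified weight `W_ε = (φ̃_ε ⋆ g + 2ε)^q`
(`bumpOf ε`), with every ε-dependent quantity on the right replaced by its `ε = 0` value at the cost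
of an error `C·ε` UNIFORM on the time window (`TopEig.weight_deriv_le_uniform`):

`Ḟ_ε(σ) ≤ −ν(1−β)·Q_τ(σ) + 2βν·Φ(u σ) + K_c ν^{−γ}·Z₀(σ) Φ(u σ)^{1+1/σ} + C ε`,
`0 ≤ F_ε(σ) − Φ(u σ) ≤ C ε`  (`0 < ε ≤ 1`, `σ ∈ [a, b]`),

where `Φ(v) = ∫ g(S_v)^q`, `Z₀ = ∫ g(S)²`, and `Q_τ(σ) = (Φ(u σ) − Φ(u σ + τΔu σ))/τ` is the
difference quotient along the HEAT LINE whose supremum over `τ > 0` is the dictionary's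
`heatDissipation Φ (u σ)` (the viscous term is converted by `TopEig.mul_integral_fderiv_weight_laplacian_le`).
Tools: the moduli `(x + η)^p − x^p ≤ p η (x + η)^{p−1}` (Bernoulli) and uniform bounds for `g(S)` on
the compact window (`Torus.exists_norm_le_of_continuousOn_of_isCompact`). [ours]
-/

noncomputable section

open MeasureTheory Set Filter Topology Finset
open scoped InnerProductSpace RealInnerProductSpace ContDiff

namespace Summit.NavierStokesRegularity.FunctionalMining

open Literature.Analysis.FunctionSpaces Literature.Analysis.FluidPDE

namespace TopEig

open StrainL4 StrainMoment VorticityL4 StrainTensor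

/-! ## 1. Scalar moduli -/

/-- **`(x + η)^p − x^p ≤ p η (x + η)^{p−1}`** for `x, η ≥ 0`, `p ≥ 1` (Bernoulli's inequality at
`s = −η/(x+η)`). [folklore] -/
theorem rpow_add_sub_rpow_le {x η p : ℝ} (hx : 0 ≤ x) (hη : 0 ≤ η) (hp : 1 ≤ p) :
    (x + η) ^ p - x ^ p ≤ p * η * (x + η) ^ (p - 1) := by
  rcases eq_or_lt_of_le (add_nonneg hx hη) with hy | hy
  · have hx0 : x = 0 := by linarith
    have hη0 : η = 0 := by linarith
    rw [hx0, hη0, add_zero, Real.zero_rpow (by linarith), mul_zero, zero_mul, sub_self]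
  · set y : ℝ := x + η with hydef
    have hs : -1 ≤ -η / y := by
      rw [neg_div, neg_le_neg_iff, div_le_one hy]; linarith
    have hB := one_add_mul_self_le_rpow_one_add hs hp
    have e1 : 1 + -η / y = x / y := by field_simp; ring
    rw [e1, Real.div_rpow hx hy.le] at hB
    -- `1 - pη/y ≤ x^p / y^p`; multiply by `y^p`
    have hyp : 0 < y ^ p := Real.rpow_pos_of_pos hy _
    have h2 : y ^ p * (1 + p * (-η / y)) ≤ x ^ p := by
      have := mul_le_mul_of_nonneg_left hB hyp.le
      rwa [mul_div_cancel₀ _ hyp.ne'] at this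
    have e2 : y ^ p * (1 + p * (-η / y)) = y ^ p - p * η * y ^ (p - 1) := by
      rw [Real.rpow_sub_one hy.ne']
      field_simp
      ring
    linarith [e2 ▸ h2]

/-- Uniform version on a bounded range: `0 ≤ x ≤ X`, `0 ≤ η ≤ H`, `p ≥ 1` ⇒
`(x + η)^p − x^p ≤ p (X + H)^{p−1} η`. [folklore] -/
theorem rpow_add_sub_rpow_le_of_le {x η p X H : ℝ} (hx : 0 ≤ x) (hxX : x ≤ X) (hη : 0 ≤ η)
    (hηH : η ≤ H) (hp : 1 ≤ p) : (x + η) ^ p - x ^ p ≤ p * (X + H) ^ (p - 1) * η := by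
  have h1 := rpow_add_sub_rpow_le hx hη hp
  have h2 : (x + η) ^ (p - 1) ≤ (X + H) ^ (p - 1) :=
    Real.rpow_le_rpow (add_nonneg hx hη) (add_le_add hxX hηH) (by linarith)
  have hp0 : 0 ≤ p := by linarith
  calc (x + η) ^ p - x ^ p ≤ p * η * (x + η) ^ (p - 1) := h1
    _ ≤ p * η * (X + H) ^ (p - 1) := mul_le_mul_of_nonneg_left h2 (mul_nonneg hp0 hη)
    _ = p * (X + H) ^ (p - 1) * η := by ring

/-! ## 2. Integral moduli on the torus -/

section Integral

variable {d : Type*} [Fintype d]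

/-- `∫ (h + η)^p − ∫ h^p ≤ p (G + H)^{p−1} η` for a continuous `0 ≤ h ≤ G` on `T^d`, `0 ≤ η ≤ H`,
`p ≥ 1` (the torus has volume one). [folklore] -/
theorem integral_add_rpow_sub_le {h : UnitAddTorus d → ℝ} (hc : Continuous h) (h0 : ∀ y, 0 ≤ h y)
    {G : ℝ} (hG : ∀ y, h y ≤ G) {η H p : ℝ} (hη : 0 ≤ η) (hηH : η ≤ H) (hp : 1 ≤ p) :
    (∫ y, (h y + η) ^ p) - ∫ y, h y ^ p ≤ p * (G + H) ^ (p - 1) * η := by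
  have hp0 : 0 ≤ p := by linarith
  have hi1 : Integrable (fun y => (h y + η) ^ p) :=
    ((hc.add continuous_const).rpow_const fun y => Or.inr hp0).integrable_unitAddTorus
  have hi2 : Integrable (fun y => h y ^ p) := (hc.rpow_const fun y => Or.inr hp0).integrable_unitAddTorus
  rw [← integral_sub hi1 hi2]
  calc ∫ y, ((h y + η) ^ p - h y ^ p) ≤ ∫ _y : UnitAddTorus d, p * (G + H) ^ (p - 1) * η :=
        integral_mono (hi1.sub hi2) (integrable_const _)
          fun y => rpow_add_sub_rpow_le_of_le (h0 y) (hG y) hη hηH hp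
    _ = p * (G + H) ^ (p - 1) * η := by simp

end Integral

/-! ## 3. A uniform bound for `g(S)` on a compact time window -/

/-- For a jointly smooth tensor field `Θ` on `S × T^d`, a continuous `g` and a compact `K ⊆ S`:
`|g(Θ s y)| ≤ G` for all `s ∈ K`, `y`, some `G ≥ 0`. [folklore] -/
theorem exists_abs_comp_le {d : Type*} [Fintype d] {E : Type*} [NormedAddCommGroup E]
    [NormedSpace ℝ E] {S K : Set ℝ} {Θ : ℝ → UnitAddTorus d → E}
    (hΘ : Torus.IsSmoothSpaceTimeOn S Θ) {g : E → ℝ} (hg : Continuous g) (hK : IsCompact K)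
    (hKS : K ⊆ S) : ∃ G : ℝ, 0 ≤ G ∧ ∀ s ∈ K, ∀ y, |g (Θ s y)| ≤ G := by
  have hc : ContinuousOn (Torus.stLift fun s y => g (Θ s y)) (S ×ˢ univ) :=
    hg.comp_continuousOn hΘ.continuousOn_stLift
  obtain ⟨C, hC⟩ := Torus.exists_norm_le_of_continuousOn_of_isCompact hc hK hKS
  refine ⟨max C 0, le_max_right _ _, fun s hs y => ?_⟩
  have h := hC s hs y
  rw [Real.norm_eq_abs] at h
  exact h.trans (le_max_left _ _)

/-! ## 4. The ε-uniform inequality -/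

/-- **ε-uniform `T_LD` inequality for the mollified weight** (module docstring). Given the abstract
derivative bound of `TopEig.weight_hasDerivWithinAt_TLD'` (hypothesis `hKc`, any bump `φ`), an
admissible `g`, real `q ≥ 2`, `0 < β ≤ 1`, `τ > 0` and a classical solution on `[a, b]` (`ν > 0`):
there is `C ≥ 0` such that for every `0 < ε ≤ 1` and `σ ∈ [a, b]`, `F_ε(σ) = ∫ W_ε(S(u σ))`
(`W_ε` = the weight of `bumpOf ε`) satisfies `0 ≤ F_ε(σ) − Φ(u σ) ≤ Cε` and has a one-sided derivative
`D ≤ −ν(1−β) Q_τ(σ) + 2βν Φ(u σ) + K_c ν^{−γ} Z₀(σ) Φ(u σ)^{1+1/σ} + Cε`. [ours] -/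
theorem weight_deriv_le_uniform {q : ℝ} (hq : 2 ≤ q) {CP : ℝ}
    {β : ℝ} (hβ0 : 0 < β) (hβ1 : β ≤ 1) {Kc : ℝ} (hKc0 : 0 ≤ Kc)
    (hKc : ∀ {a b ν : ℝ}, a < b → 0 < ν →
      ∀ {u : ℝ → UnitAddTorus (Fin 3) → EuclideanSpace ℝ (Fin 3)} {p : ℝ → UnitAddTorus (Fin 3) → ℝ},
      Torus.IsClassicalNSSolutionOn (Icc a b) ν 0 u p →
      (∀ t ∈ Icc a b, ∀ i j : Fin 3,
        ∫ x, |Torus.partialDeriv i (Torus.partialDeriv j (p t)) x| ^ q ≤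
          CP * ∫ x, (∑ k, ‖Torus.partialDeriv k (u t) x‖ ^ 2) ^ q) →
      ∀ {g : EuclideanSpace ℝ (Fin 3 × Fin 3) → ℝ}, ConvexOn ℝ univ g → LipschitzWith 1 g →
      (∀ v : UnitAddTorus (Fin 3) → EuclideanSpace ℝ (Fin 3), Torus.IsSmooth v →
        Torus.IsDivFree v → ∀ x, 0 ≤ g (strainFlat v x)) →
      (∀ v : UnitAddTorus (Fin 3) → EuclideanSpace ℝ (Fin 3), Torus.IsSmooth v →
        Torus.IsDivFree v → ∀ x, ‖strainFlat v x‖ ≤ 6 * g (strainFlat v x)) →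
      ∀ (φ : ContDiffBump (0 : EuclideanSpace ℝ (Fin 3 × Fin 3))) {τ : ℝ}, τ ∈ Icc a b →
      ∃ D : ℝ, HasDerivWithinAt (fun s => ∫ y, weight φ g q (strainFlat (u s) y)) D (Icc a b) τ ∧
        D ≤ ν * (1 - β) *
              (∫ y, fderiv ℝ (weight φ g q) (strainFlat (u τ) y)
                (Torus.laplacian (strainFlat (u τ)) y)) +
            2 * β * ν * (∫ y, weight φ g q (strainFlat (u τ) y)) +
            Kc * ν ^ (-((3 * q - 3) / (2 * q - 3))) *
              ((∫ y, lamReg φ g (strainFlat (u τ) y) ^ (2 : ℝ)) *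
                (∫ y, weight φ g q (strainFlat (u τ) y)) ^ (1 + (2 * q - 3)⁻¹)))
    {a b ν : ℝ} (hab : a < b) (hν : 0 < ν)
    {u : ℝ → UnitAddTorus (Fin 3) → EuclideanSpace ℝ (Fin 3)} {p : ℝ → UnitAddTorus (Fin 3) → ℝ}
    (hsol : Torus.IsClassicalNSSolutionOn (Icc a b) ν 0 u p)
    (hCP : ∀ t ∈ Icc a b, ∀ i j : Fin 3,
      ∫ x, |Torus.partialDeriv i (Torus.partialDeriv j (p t)) x| ^ q ≤
        CP * ∫ x, (∑ k, ‖Torus.partialDeriv k (u t) x‖ ^ 2) ^ q)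
    {g : EuclideanSpace ℝ (Fin 3 × Fin 3) → ℝ} (hconv : ConvexOn ℝ univ g) (hlip : LipschitzWith 1 g)
    (hg0 : ∀ v : UnitAddTorus (Fin 3) → EuclideanSpace ℝ (Fin 3), Torus.IsSmooth v →
      Torus.IsDivFree v → ∀ x, 0 ≤ g (strainFlat v x))
    (hg6 : ∀ v : UnitAddTorus (Fin 3) → EuclideanSpace ℝ (Fin 3), Torus.IsSmooth v →
      Torus.IsDivFree v → ∀ x, ‖strainFlat v x‖ ≤ 6 * g (strainFlat v x))
    {τ : ℝ} (hτ : 0 < τ) :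
    ∃ C : ℝ, 0 ≤ C ∧ ∀ (ε : ℝ) (hε : 0 < ε), ε ≤ 1 → ∀ σ ∈ Icc a b,
      (∫ y, g (strainFlat (u σ) y) ^ q) ≤ (∫ y, weight (bumpOf ε hε) g q (strainFlat (u σ) y)) ∧
      (∫ y, weight (bumpOf ε hε) g q (strainFlat (u σ) y)) - (∫ y, g (strainFlat (u σ) y) ^ q) ≤ C * ε ∧
      ∃ D : ℝ, HasDerivWithinAt (fun s => ∫ y, weight (bumpOf ε hε) g q (strainFlat (u s) y)) D
          (Icc a b) σ ∧
        D ≤ -(ν * (1 - β)) * (((∫ y, g (strainFlat (u σ) y) ^ q) -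
              ∫ y, g (strainFlat (u σ + τ • Torus.laplacian (u σ)) y) ^ q) / τ) +
            2 * β * ν * (∫ y, g (strainFlat (u σ) y) ^ q) +
            Kc * ν ^ (-((3 * q - 3) / (2 * q - 3))) *
              ((∫ y, g (strainFlat (u σ) y) ^ (2 : ℝ)) *
                (∫ y, g (strainFlat (u σ) y) ^ q) ^ (1 + (2 * q - 3)⁻¹)) + C * ε := by
  have hq0 : 0 < q := by linarith
  have hq1 : (1 : ℝ) ≤ q := by linarith
  have hU : UniqueDiffOn ℝ (Icc a b) := uniqueDiffOn_Icc hab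
  have hu : Torus.IsSmoothSpaceTimeOn (Icc a b) u := hsol.smooth_velocity
  have hgc : Continuous g := hlip.continuous
  -- the two jointly smooth strain fields: along `u` and along the heat line `u + τΔu`
  have hΘ : Torus.IsSmoothSpaceTimeOn (Icc a b) (fun s y => strainFlat (u s) y) :=
    isSmoothSpaceTimeOn_strainFlat hu hU
  have huτ : Torus.IsSmoothSpaceTimeOn (Icc a b) (fun s => u s + τ • Torus.laplacian (u s)) :=
    hu.add ((hu.laplacian hU).const_smul τ)
  have hΘτ : Torus.IsSmoothSpaceTimeOn (Icc a b)
      (fun s y => strainFlat (u s + τ • Torus.laplacian (u s)) y) :=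
    isSmoothSpaceTimeOn_strainFlat huτ hU
  -- uniform bounds `0 ≤ g(S) ≤ G`, `0 ≤ g(S_τ) ≤ Gτ` on the window
  obtain ⟨G, hG0, hG⟩ := exists_abs_comp_le hΘ hgc isCompact_Icc subset_rfl
  obtain ⟨Gτ, hGτ0, hGτ⟩ := exists_abs_comp_le hΘτ hgc isCompact_Icc subset_rfl
  -- exponents and constants
  set pq : ℝ := 1 + (2 * q - 3)⁻¹ with hpq
  have h23 : 0 < 2 * q - 3 := by linarith
  have hpq1 : 1 ≤ pq := by rw [hpq]; have := inv_pos.2 h23; linarith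
  set γ : ℝ := (3 * q - 3) / (2 * q - 3) with hγ
  set C₁ : ℝ := q * (G + 3) ^ (q - 1) * 3 with hC₁
  set C₂ : ℝ := q * (Gτ + 3) ^ (q - 1) * 3 with hC₂
  set C₃ : ℝ := 2 * (G + 3) ^ ((2 : ℝ) - 1) * 3 with hC₃
  set C₄ : ℝ := pq * (G ^ q + C₁) ^ (pq - 1) * C₁ with hC₄
  set C₅ : ℝ := C₃ * ((G ^ q + C₁) ^ pq) + C₃ * C₄ + G ^ (2 : ℝ) * C₄ with hC₅
  have hpq0 : 0 ≤ pq := by linarith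
  have hC₁0 : 0 ≤ C₁ := by
    rw [hC₁]; exact mul_nonneg (mul_nonneg hq0.le (Real.rpow_nonneg (by linarith) _)) (by norm_num)
  have hC₂0 : 0 ≤ C₂ := by
    rw [hC₂]; exact mul_nonneg (mul_nonneg hq0.le (Real.rpow_nonneg (by linarith) _)) (by norm_num)
  have hC₃0 : 0 ≤ C₃ := by
    rw [hC₃]; exact mul_nonneg (mul_nonneg (by norm_num) (Real.rpow_nonneg (by linarith) _)) (by norm_num)
  have hGq0 : 0 ≤ G ^ q + C₁ := add_nonneg (Real.rpow_nonneg hG0 _) hC₁0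
  have hC₄0 : 0 ≤ C₄ := by
    rw [hC₄]; exact mul_nonneg (mul_nonneg hpq0 (Real.rpow_nonneg hGq0 _)) hC₁0
  have hC₅0 : 0 ≤ C₅ := by
    rw [hC₅]
    exact add_nonneg (add_nonneg (mul_nonneg hC₃0 (Real.rpow_nonneg hGq0 _)) (mul_nonneg hC₃0 hC₄0))
      (mul_nonneg (Real.rpow_nonneg hG0 _) hC₄0)
  have hνγ : 0 ≤ ν ^ (-γ) := Real.rpow_nonneg hν.le _
  have h1β : 0 ≤ 1 - β := by linarith
  set C : ℝ := C₁ + (ν * (1 - β) * C₂ / τ + 2 * β * ν * C₁ + Kc * ν ^ (-γ) * C₅) with hCdef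
  have hR0 : 0 ≤ ν * (1 - β) * C₂ / τ + 2 * β * ν * C₁ + Kc * ν ^ (-γ) * C₅ := by
    refine add_nonneg (add_nonneg ?_ ?_) ?_
    · exact div_nonneg (mul_nonneg (mul_nonneg hν.le h1β) hC₂0) hτ.le
    · exact mul_nonneg (mul_nonneg (mul_nonneg (by norm_num) hβ0.le) hν.le) hC₁0
    · exact mul_nonneg (mul_nonneg hKc0 hνγ) hC₅0
  have hC0 : 0 ≤ C := by rw [hCdef]; exact add_nonneg hC₁0 hR0
  have hC₁C : C₁ ≤ C := by rw [hCdef]; linarith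
  refine ⟨C, hC0, fun ε hε hε1 σ hσ => ?_⟩
  -- data at time `σ`
  have huσ : Torus.IsSmooth (u σ) := hu.isSmooth_slice hσ
  have hdivσ : Torus.IsDivFree (u σ) := hsol.divFree σ hσ
  have hvσ : Torus.IsSmooth (u σ + τ • Torus.laplacian (u σ)) := isSmooth_heatLine huσ τ
  have hdivvσ : Torus.IsDivFree (u σ + τ • Torus.laplacian (u σ)) :=
    isDivFree_add_smul huσ huσ.laplacian hdivσ (isDivFree_laplacian huσ hdivσ) τ
  set φ := bumpOf ε hε with hφ
  have hr : φ.rOut = ε := bumpOf_rOut ε hε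
  -- the densities `h = g(S(u σ))`, `hτ' = g(S(u σ + τΔu σ))`
  set h : UnitAddTorus (Fin 3) → ℝ := fun y => g (strainFlat (u σ) y) with hh
  set hv : UnitAddTorus (Fin 3) → ℝ := fun y => g (strainFlat (u σ + τ • Torus.laplacian (u σ)) y)
    with hhv
  have hhc : Continuous h := hgc.comp (continuous_strainFlat huσ)
  have hhvc : Continuous hv := hgc.comp (continuous_strainFlat hvσ)
  have hh0 : ∀ y, 0 ≤ h y := fun y => hg0 _ huσ hdivσ y
  have hhv0 : ∀ y, 0 ≤ hv y := fun y => hg0 _ hvσ hdivvσ y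
  have hhG : ∀ y, h y ≤ G := fun y => (le_abs_self _).trans (hG σ hσ y)
  have hhvG : ∀ y, hv y ≤ Gτ := fun y => (le_abs_self _).trans (hGτ σ hσ y)
  have h3ε : 0 ≤ 3 * ε := by positivity
  have h3ε3 : 3 * ε ≤ 3 := by linarith
  -- `Φσ = ∫ h^q`, `Fε = ∫ W_ε(S)`, sandwich
  obtain ⟨f, hf⟩ : ∃ f : ℝ, f = ∫ y, h y ^ q := ⟨_, rfl⟩
  obtain ⟨Fε, hFε⟩ : ∃ F : ℝ, F = ∫ y, weight φ g q (strainFlat (u σ) y) := ⟨_, rfl⟩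
  obtain ⟨Z₀, hZ₀⟩ : ∃ Z : ℝ, Z = ∫ y, h y ^ (2 : ℝ) := ⟨_, rfl⟩
  obtain ⟨Zε, hZε⟩ : ∃ Z : ℝ, Z = ∫ y, lamReg φ g (strainFlat (u σ) y) ^ (2 : ℝ) := ⟨_, rfl⟩
  have hf0 : 0 ≤ f := by rw [hf]; exact integral_nonneg fun y => Real.rpow_nonneg (hh0 y) _
  have hZ₀0 : 0 ≤ Z₀ := by rw [hZ₀]; exact integral_nonneg fun y => Real.rpow_nonneg (hh0 y) _
  have hfG : f ≤ G ^ q := by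
    rw [hf]
    calc ∫ y, h y ^ q ≤ ∫ _y : UnitAddTorus (Fin 3), G ^ q :=
          integral_mono ((hhc.rpow_const fun y => Or.inr hq0.le).integrable_unitAddTorus)
            (integrable_const _) fun y => Real.rpow_le_rpow (hh0 y) (hhG y) hq0.le
      _ = G ^ q := by simp
  have hZ₀G : Z₀ ≤ G ^ (2 : ℝ) := by
    rw [hZ₀]
    calc ∫ y, h y ^ (2 : ℝ) ≤ ∫ _y : UnitAddTorus (Fin 3), G ^ (2 : ℝ) :=
          integral_mono ((hhc.rpow_const fun y => Or.inr (by norm_num)).integrable_unitAddTorus)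
            (integrable_const _) fun y => Real.rpow_le_rpow (hh0 y) (hhG y) (by norm_num)
      _ = G ^ (2 : ℝ) := by simp
  -- sandwich bounds for the regularised quantities
  have hwc : ∀ {v : UnitAddTorus (Fin 3) → EuclideanSpace ℝ (Fin 3)}, Torus.IsSmooth v → ∀ r : ℝ,
      0 ≤ r → Continuous fun y => weight φ g r (strainFlat v y) := fun hv r hr =>
    ((contDiff_lamReg φ hgc).continuous.comp (continuous_strainFlat hv)).rpow_const fun _ => Or.inr hr
  have hlow : f ≤ Fε := by
    rw [hf, hFε]
    exact integral_mono_of_nonneg (ae_of_all _ fun y => Real.rpow_nonneg (hh0 y) _)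
      (hwc huσ q hq0.le).integrable_unitAddTorus
      (ae_of_all _ fun y => (weight_mem_Icc φ hlip hq0.le (hh0 y)).1)
  have hupp : Fε ≤ ∫ y, (h y + 3 * ε) ^ q := by
    rw [hFε]
    refine integral_mono_of_nonneg (ae_of_all _ fun y => ?_)
      (((hhc.add continuous_const).rpow_const fun y => Or.inr hq0.le).integrable_unitAddTorus)
      (ae_of_all _ fun y => ?_)
    · exact weight_nonneg φ q (mem_posSet_of_nonneg φ hlip (hh0 y)).1
    · have h2 := (weight_mem_Icc φ hlip hq0.le (hh0 y)).2
      rw [hr] at h2; exact h2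
  have hFεf : Fε - f ≤ C₁ * ε := by
    have hm := integral_add_rpow_sub_le hhc hh0 hhG h3ε h3ε3 hq1
    rw [← hf] at hm
    calc Fε - f ≤ (∫ y, (h y + 3 * ε) ^ q) - f := by linarith
      _ ≤ q * (G + 3) ^ (q - 1) * (3 * ε) := hm
      _ = C₁ * ε := by rw [hC₁]; ring
  have hFε0 : 0 ≤ Fε := hf0.trans hlow
  -- the heat-line value
  have huppv : (∫ y, weight φ g q (strainFlat (u σ + τ • Torus.laplacian (u σ)) y)) ≤
      (∫ y, hv y ^ q) + C₂ * ε := by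
    have h1 : (∫ y, weight φ g q (strainFlat (u σ + τ • Torus.laplacian (u σ)) y)) ≤
        ∫ y, (hv y + 3 * ε) ^ q := by
      refine integral_mono_of_nonneg (ae_of_all _ fun y => ?_)
        (((hhvc.add continuous_const).rpow_const fun y => Or.inr hq0.le).integrable_unitAddTorus)
        (ae_of_all _ fun y => ?_)
      · exact weight_nonneg φ q (mem_posSet_of_nonneg φ hlip (hhv0 y)).1
      · have h2 := (weight_mem_Icc φ hlip hq0.le (hhv0 y)).2
        rw [hr] at h2; exact h2
    have hm := integral_add_rpow_sub_le hhvc hhv0 hhvG h3ε h3ε3 hq1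
    calc _ ≤ ∫ y, (hv y + 3 * ε) ^ q := h1
      _ ≤ (∫ y, hv y ^ q) + q * (Gτ + 3) ^ (q - 1) * (3 * ε) := by linarith
      _ = (∫ y, hv y ^ q) + C₂ * ε := by rw [hC₂]; ring
  -- `Zε ≤ Z₀ + C₃ ε`
  have hZεle : Zε ≤ Z₀ + C₃ * ε := by
    have h1 : Zε ≤ ∫ y, (h y + 3 * ε) ^ (2 : ℝ) := by
      rw [hZε]
      refine integral_mono_of_nonneg (ae_of_all _ fun y => ?_)
        (((hhc.add continuous_const).rpow_const fun y => Or.inr (by norm_num)).integrable_unitAddTorus)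
        (ae_of_all _ fun y => ?_)
      · exact Real.rpow_nonneg (mem_posSet_of_nonneg φ hlip (hh0 y)).1.le _
      · have h2 := (lamReg_mem_Icc φ hlip (strainFlat (u σ) y)).2
        rw [hr] at h2
        exact Real.rpow_le_rpow (mem_posSet_of_nonneg φ hlip (hh0 y)).1.le h2 (by norm_num)
    have hm := integral_add_rpow_sub_le hhc hh0 hhG h3ε h3ε3 (p := 2) (by norm_num)
    rw [← hZ₀] at hm
    calc Zε ≤ ∫ y, (h y + 3 * ε) ^ (2 : ℝ) := h1
      _ ≤ Z₀ + 2 * (G + 3) ^ ((2 : ℝ) - 1) * (3 * ε) := by linarith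
      _ = Z₀ + C₃ * ε := by rw [hC₃]; ring
  have hZε0 : 0 ≤ Zε := by
    rw [hZε]; exact integral_nonneg fun y => Real.rpow_nonneg (mem_posSet_of_nonneg φ hlip (hh0 y)).1.le _
  -- `Fε^pq ≤ f^pq + C₄ ε` and the product
  have hFεp : Fε ^ pq ≤ f ^ pq + C₄ * ε := by
    have h1 : Fε ^ pq ≤ (f + C₁ * ε) ^ pq :=
      Real.rpow_le_rpow hFε0 (by linarith) (by linarith)
    have hm := rpow_add_sub_rpow_le_of_le hf0 hfG (mul_nonneg hC₁0 hε.le)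
      (mul_le_of_le_one_right hC₁0 hε1) hpq1
    calc Fε ^ pq ≤ (f + C₁ * ε) ^ pq := h1
      _ ≤ f ^ pq + pq * (G ^ q + C₁) ^ (pq - 1) * (C₁ * ε) := by linarith
      _ = f ^ pq + C₄ * ε := by rw [hC₄]; ring
  have hfp0 : 0 ≤ f ^ pq := Real.rpow_nonneg hf0 _
  have hfpG : f ^ pq ≤ (G ^ q + C₁) ^ pq :=
    Real.rpow_le_rpow hf0 (by linarith) (by linarith)
  have hprodle : Zε * Fε ^ pq ≤ Z₀ * f ^ pq + C₅ * ε := by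
    have h1 : Zε * Fε ^ pq ≤ (Z₀ + C₃ * ε) * (f ^ pq + C₄ * ε) :=
      mul_le_mul hZεle hFεp (Real.rpow_nonneg hFε0 _) (add_nonneg hZ₀0 (mul_nonneg hC₃0 hε.le))
    have h2 : (Z₀ + C₃ * ε) * (f ^ pq + C₄ * ε) =
        Z₀ * f ^ pq + ε * (C₃ * f ^ pq + Z₀ * C₄ + C₃ * C₄ * ε) := by ring
    have h3 : C₃ * f ^ pq + Z₀ * C₄ + C₃ * C₄ * ε ≤ C₅ := by
      rw [hC₅]
      have e1 : C₃ * f ^ pq ≤ C₃ * (G ^ q + C₁) ^ pq := mul_le_mul_of_nonneg_left hfpG hC₃0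
      have e1' : C₃ * C₄ * ε ≤ C₃ * C₄ := mul_le_of_le_one_right (mul_nonneg hC₃0 hC₄0) hε1
      have e2 : Z₀ * C₄ ≤ G ^ (2 : ℝ) * C₄ := mul_le_mul_of_nonneg_right hZ₀G hC₄0
      linarith
    rw [h2] at h1
    have h4 : ε * (C₃ * f ^ pq + Z₀ * C₄ + C₃ * C₄ * ε) ≤ ε * C₅ :=
      mul_le_mul_of_nonneg_left h3 hε.le
    linarith
  -- the derivative bound of `TopEigBalanceTLD`
  obtain ⟨D, hD, hle⟩ := hKc hab hν hsol hCP hconv hlip hg0 hg6 φ hσ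
  have ef : (∫ y, g (strainFlat (u σ) y) ^ q) = f := by rw [hf]
  have eZ : (∫ y, g (strainFlat (u σ) y) ^ (2 : ℝ)) = Z₀ := by rw [hZ₀]
  have ev : (∫ y, g (strainFlat (u σ + τ • Torus.laplacian (u σ)) y) ^ q) = ∫ y, hv y ^ q := rfl
  refine ⟨?_, ?_, D, hD, ?_⟩
  · rw [← hFε, ef]; exact hlow
  · rw [← hFε, ef]
    exact hFεf.trans (mul_le_mul_of_nonneg_right hC₁C hε.le)
  -- the viscous term against the heat line
  have hV := mul_integral_fderiv_weight_laplacian_le φ hconv hlip hg0 hq1 huσ hdivσ τ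
  set V := ∫ y, fderiv ℝ (weight φ g q) (strainFlat (u σ) y) (Torus.laplacian (strainFlat (u σ)) y)
    with hVdef
  rw [← hFε] at hV
  have hVle : V ≤ ((∫ y, hv y ^ q) + C₂ * ε - f) / τ := by
    rw [le_div_iff₀ hτ]
    linarith
  rw [← hFε, ← hZε] at hle
  rw [ef, eZ, ev]
  have hQ : ν * (1 - β) * V ≤ -(ν * (1 - β)) * ((f - ∫ y, hv y ^ q) / τ) + ν * (1 - β) * C₂ / τ * ε := by
    have h1 := mul_le_mul_of_nonneg_left hVle (mul_nonneg hν.le h1β)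
    have e : ν * (1 - β) * (((∫ y, hv y ^ q) + C₂ * ε - f) / τ) =
        -(ν * (1 - β)) * ((f - ∫ y, hv y ^ q) / τ) + ν * (1 - β) * C₂ / τ * ε := by
      field_simp
      ring
    linarith
  have h2β : 2 * β * ν * Fε ≤ 2 * β * ν * f + 2 * β * ν * C₁ * ε := by
    have := mul_le_mul_of_nonneg_left hFεf
      (mul_nonneg (mul_nonneg (by norm_num) hβ0.le) hν.le : (0 : ℝ) ≤ 2 * β * ν)
    linarith
  have hKterm : Kc * ν ^ (-γ) * (Zε * Fε ^ pq) ≤ Kc * ν ^ (-γ) * (Z₀ * f ^ pq) + Kc * ν ^ (-γ) * C₅ * ε := by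
    have := mul_le_mul_of_nonneg_left hprodle (mul_nonneg hKc0 hνγ)
    linarith
  calc D ≤ ν * (1 - β) * V + 2 * β * ν * Fε + Kc * ν ^ (-γ) * (Zε * Fε ^ pq) := hle
    _ ≤ (-(ν * (1 - β)) * ((f - ∫ y, hv y ^ q) / τ) + ν * (1 - β) * C₂ / τ * ε) +
        (2 * β * ν * f + 2 * β * ν * C₁ * ε) +
        (Kc * ν ^ (-γ) * (Z₀ * f ^ pq) + Kc * ν ^ (-γ) * C₅ * ε) := add_le_add (add_le_add hQ h2β) hKterm
    _ = -(ν * (1 - β)) * ((f - ∫ y, hv y ^ q) / τ) + 2 * β * ν * f + Kc * ν ^ (-γ) * (Z₀ * f ^ pq) +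
        (ν * (1 - β) * C₂ / τ + 2 * β * ν * C₁ + Kc * ν ^ (-γ) * C₅) * ε := by ring
    _ ≤ -(ν * (1 - β)) * ((f - ∫ y, hv y ^ q) / τ) + 2 * β * ν * f + Kc * ν ^ (-γ) * (Z₀ * f ^ pq) +
        C * ε := by
        have hle' : (ν * (1 - β) * C₂ / τ + 2 * β * ν * C₁ + Kc * ν ^ (-γ) * C₅) ≤ C := by
          rw [hCdef]; linarith
        have := mul_le_mul_of_nonneg_right hle' hε.le
        linarith

end TopEig

end Summit.NavierStokesRegularity.FunctionalMining

end
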